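import Mathlib.LinearAlgebra.Finsupp.Supported
import Mathlib.Data.ZMod.Basic
import Mathlib.Data.Fintype.EquivFin
import Summits.BirchSwinnertonDyer.BirchSwinnertonDyer.Theorems.ClassRecordThreeEulerHalvesAtThreeCoreVertex
import HarnessLib

/-!
# ANTI-VACUITY of the kernel Prop. 6.4: the hypotheses of `JET.Section6.exists_halfCoreVertex`
# (`…EulerHalvesAtThreeCoreVertex.lean`, p484455) are JOINTLY SATISFIABLE — a toy Kolyvagin system
# on `(Finset ℕ × Bool) →₀ ℤ/3` (cell `bsd-stepL`, seat `bsd-stepL-tam3-p1`, helper toward item 19109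
# `EulerHalvesAtThree`; pattern of `Rank1ResidualJetSection6Sanity.lean` p477224 ∕ x11b3
# `LayerDataAntiVacuity.lean`)

THEOREMS ONLY; nothing about elliptic curves is asserted; no item closes; 0 classes move (T7);
`--supports stmt-BirchSwinnertonDyer-19109` (helper). A theorem with seventeen structural hypotheses
is worthless if they contradict each other. `exists_halfCoreVertex` quantifies its Selmer data over
ALL conductors `n : Finset P` and its Čebotarev hypothesis `h61` over all `n`, which forces `P`
infinite and the ambient group infinitely generated in any model with a non-zero class; so the toy
is a genuine miniature Kolyvagin system: primes `P = ℕ`; `G = (Finset ℕ × Bool) →₀ ℤ/3` with basis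
vectors `v(m, s)`; all local groups `L ℓ = G`, `loc ℓ = id`; `Hf ℓ` = vectors supported on indices
`(m, s)` with `ℓ ∉ m`, `Htr ℓ` = those with `ℓ ∈ m` (disjoint supports); sign `e n = [#n even]`
(flips under `insert`); `Sel n s = ℤ/3·v(n, s)` if `s = e n` else `0`; `Rel n ℓ s = ℤ/3·v(n, s)` if
`s = e n` else `ℤ/3·v(insert ℓ n, s)` (order 3 = `p^k`, `k = 1`: the duality count); `Gs = ⊤`;
`κ = κ̃ = v(n, e n)` (order 3), `m = m' = 0`, `M = ⊤`. `exists_halfCoreVertex_toy` is the abstract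
theorem ELABORATED on this model with every binder discharged (so its conclusion, here the trivially
true statement that the empty conductor is a half-core vertex, is obtained THROUGH the theorem).
[folklore] Axioms: `propext`, `Classical.choice`, `Quot.sound`.
-/

set_option autoImplicit false

noncomputable section

open scoped Classical

namespace Summit.BirchSwinnertonDyer.Rank1Residual.JET.Section6

/-- **Toy model for `exists_halfCoreVertex` (p = 3, k = 1).** Primes `P = ℕ`; ambient group
`G = (Finset ℕ × Bool) →₀ ℤ/3` with basis vectors `v(m, s)`; every local group `L ℓ = G` with
`loc ℓ = id`, `Hf ℓ` = the vectors supported on indices `(m, s)` with `ℓ ∉ m`, `Htr ℓ` = those with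
`ℓ ∈ m` (disjoint); sign `e n = [#n even]`; `Sel n s = ℤ/3 · v(n, s)` if `s = e n`, else `0`;
`Rel n ℓ s = ℤ/3 · v(n, s)` if `s = e n`, else `ℤ/3 · v(insert ℓ n, s)`; `κ = κ̃ = v(n, e n)`,
`m = m' = 0`, `M = ⊤`, `Gs = ⊤`. Every hypothesis of `exists_halfCoreVertex` holds (Lemma 6.1 because
`ℕ` is infinite and `loc` is injective; the duality count because each `Rel` has order 3), and the
theorem returns its conclusion on this model — so its hypothesis list is not contradictory. Nothing
about elliptic curves is asserted; 0 classes move. [folklore] -/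
theorem exists_halfCoreVertex_toy :
    ∃ n : Finset ℕ,
      (if (!decide (Even n.card)) = decide (Even n.card) then
          AddSubgroup.zmultiples
            (Finsupp.single (n, !decide (Even n.card)) (1 : ZMod 3))
        else (⊥ : AddSubgroup (Finset ℕ × Bool →₀ ZMod 3))) = ⊥ ∧
      (fun _ : Finset ℕ => (0 : ℕ∞)) n ≤ (fun _ : Finset ℕ => (0 : ℕ∞)) ∅ := by
  -- basis vectors, their order, the local conditions
  have hord : ∀ (m : Finset ℕ) (s : Bool),
      addOrderOf (Finsupp.single (m, s) (1 : ZMod 3)) = 3 := by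
    intro m s
    rw [← Finsupp.singleAddHom_apply, addOrderOf_injective (Finsupp.singleAddHom (m, s))
      (Finsupp.single_injective (m, s)), ZMod.addOrderOf_one]
  have hcard : ∀ (m : Finset ℕ) (s : Bool),
      Nat.card (AddSubgroup.zmultiples (Finsupp.single (m, s) (1 : ZMod 3))) = 3 := by
    intro m s; rw [Nat.card_zmultiples, hord]
  have hfinz : ∀ (m : Finset ℕ) (s : Bool),
      Finite (AddSubgroup.zmultiples (Finsupp.single (m, s) (1 : ZMod 3))) := by
    intro m s; exact Nat.finite_of_card_ne_zero (by rw [hcard]; norm_num)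
  have hHf : ∀ (ℓ : ℕ) (m : Finset ℕ) (s : Bool), ℓ ∉ m →
      AddSubgroup.zmultiples (Finsupp.single (m, s) (1 : ZMod 3)) ≤
        (Finsupp.supported (ZMod 3) (ZMod 3) {i : Finset ℕ × Bool | ℓ ∉ i.1}).toAddSubgroup := by
    intro ℓ m s h
    exact AddSubgroup.zmultiples_le_of_mem
      (Finsupp.single_mem_supported (ZMod 3) (1 : ZMod 3) (show (m, s) ∈ _ from h))
  have hHtr : ∀ (ℓ : ℕ) (m : Finset ℕ) (s : Bool), ℓ ∈ m →
      AddSubgroup.zmultiples (Finsupp.single (m, s) (1 : ZMod 3)) ≤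
        (Finsupp.supported (ZMod 3) (ZMod 3) {i : Finset ℕ × Bool | ℓ ∈ i.1}).toAddSubgroup := by
    intro ℓ m s h
    exact AddSubgroup.zmultiples_le_of_mem
      (Finsupp.single_mem_supported (ZMod 3) (1 : ZMod 3) (show (m, s) ∈ _ from h))
  have hdisj : ∀ (ℓ : ℕ), Disjoint
      (Finsupp.supported (ZMod 3) (ZMod 3) {i : Finset ℕ × Bool | ℓ ∉ i.1}).toAddSubgroup
      (Finsupp.supported (ZMod 3) (ZMod 3) {i : Finset ℕ × Bool | ℓ ∈ i.1}).toAddSubgroup := by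
    intro ℓ
    have hS := Finsupp.disjoint_supported_supported (M := ZMod 3) (R := ZMod 3)
      (s := {i : Finset ℕ × Bool | ℓ ∉ i.1}) (t := {i : Finset ℕ × Bool | ℓ ∈ i.1})
      (Set.disjoint_left.mpr fun i h1 h2 => h1 h2)
    rw [AddSubgroup.disjoint_def]
    intro x hx hy
    exact (Submodule.disjoint_def.mp hS) x hx hy
  -- the sign flips under `insert`
  have he : ∀ (n : Finset ℕ) (ℓ : ℕ), ℓ ∉ n →
      decide (Even (insert ℓ n).card) = !decide (Even n.card) := by
    intro n ℓ hℓ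
    rw [Finset.card_insert_of_notMem hℓ]
    simp only [Nat.even_add_one, decide_not]
  refine exists_halfCoreVertex (p := 3) (k := 1) Nat.prime_three (P := ℕ)
    (G := Finset ℕ × Bool →₀ ZMod 3) (L := fun _ => Finset ℕ × Bool →₀ ZMod 3)
    (fun _ => AddMonoidHom.id _)
    (fun ℓ _ => (Finsupp.supported (ZMod 3) (ZMod 3) {i : Finset ℕ × Bool | ℓ ∉ i.1}).toAddSubgroup)
    (fun ℓ _ => (Finsupp.supported (ZMod 3) (ZMod 3) {i : Finset ℕ × Bool | ℓ ∈ i.1}).toAddSubgroup)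
    (fun ℓ _ => hdisj ℓ) (fun _ => ⊤)
    (fun n s => if s = decide (Even n.card) then
      AddSubgroup.zmultiples (Finsupp.single (n, s) (1 : ZMod 3)) else ⊥)
    (fun n ℓ s => AddSubgroup.zmultiples
      (Finsupp.single ((if s = decide (Even n.card) then n else insert ℓ n), s) (1 : ZMod 3)))
    (fun _ _ => le_top) ?_ ?_ ?_ ?_ (fun n => decide (Even n.card)) he ?_
    (fun _ => ⊤) (fun _ => 0) (fun _ => 0) (fun _ _ => le_rfl) (fun _ => le_top)
    (fun n => Finsupp.single (n, decide (Even n.card)) (1 : ZMod 3))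
    (fun n => Finsupp.single (n, decide (Even n.card)) (1 : ZMod 3)) ?_ (fun _ _ _ _ => zero_le)
    ?_ (by exact_mod_cast Nat.zero_lt_one)
  · -- hfin
    intro n ℓ s _
    exact hfinz _ _
  · -- hSel
    intro n ℓ s hℓ
    simp only [AddSubgroup.comap_id]
    by_cases hs : s = decide (Even n.card)
    · rw [if_pos hs, if_pos hs]
      exact (inf_eq_left.mpr (hHf ℓ n s hℓ)).symm
    · rw [if_neg hs, if_neg hs]
      exact (((hdisj ℓ).symm.mono_left (hHtr ℓ _ s (Finset.mem_insert_self ℓ n))).eq_bot).symm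
  · -- hSelT
    intro n ℓ s hℓ
    simp only [AddSubgroup.comap_id, he n ℓ hℓ]
    by_cases hs : s = decide (Even n.card)
    · have hs' : ¬ s = !decide (Even n.card) := by rw [hs]; exact Bool.self_ne_not _
      rw [if_neg hs', if_pos hs]
      exact (((hdisj ℓ).mono_left (hHf ℓ n s hℓ)).eq_bot).symm
    · have hs' : s = !decide (Even n.card) := Bool.eq_not_iff.mpr hs
      rw [if_pos hs', if_neg hs]
      exact (inf_eq_left.mpr (hHtr ℓ _ s (Finset.mem_insert_self ℓ n))).symm
  · -- hPT
    intro n ℓ s _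
    rw [AddSubgroup.map_id, pow_one]
    exact hcard _ _
  · -- h61 (Lemma 6.1): `ℕ` is infinite and `loc = id`
    intro s x y _ _ _ n
    obtain ⟨ℓ, hℓ⟩ := Infinite.exists_notMem_finset n
    exact ⟨ℓ, hℓ, rfl, rfl⟩
  · -- hκt
    intro n _
    refine ⟨?_, ?_, ?_⟩
    · simp only [if_true]
      exact AddSubgroup.mem_zmultiples _
    · rw [pow_one]; exact hord _ _
    · simp
  · -- h47
    intro n ℓ _
    simp only [AddMonoidHom.id_apply]
    rw [hord, hord]

end Summit.BirchSwinnertonDyer.Rank1Residual.JET.Section6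

end
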